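import Summits.HodgeConjecture.HodgeConjecture.Theorems.MarkmanPartnerTransportPicardThreeK3SquaresKugaSatakePairPresentation

/-!
# Route MarkmanPartnerTransport · crux `PicardThreeK3Squares` (stmt-HodgeConjecture-19652) —
# programme «KS-PAIR», step 3: algebraic correspondences `H²(S) → H²(S')` between TWO surfaces carry
# `T(S)_ℂ` into `T(S')_ℂ`, and RATIONAL ones descend to Hodge morphisms `T(S)_ℚ → T(S')_ℚ`

The two-surface versions of gen 14's `…KugaSatakeSelfDescent` §2 (there: self-correspondences of one
surface). In the tree "induced by an algebraic cycle" (`IsAlgebraicCorrespondence 2 2 S' S f` for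
`f : H²(S(ℂ); ℂ) → H²(S'(ℂ); ℂ)`) means induced by a class of the `ℂ`-SPAN `algebraicClasses (S' ⊗ S)`, so
`f` need not preserve rational classes; the descent to the rational Hodge structures is done
generator-by-generator (rational algebraic classes span, `supportedClasses_eq_span_isRationalClass`):

* `corrAction_ofRatClass_mem_algebraicClasses₂` — `[γ]_*` (`γ ∈ A^e(S ⊗ S') ⊗ ℂ`) maps the
  complexified Hodge classes `ι n'`, `n' ∈ Hdg¹(S')`, into `N¹(S)` (Lefschetz `(1,1)` on `S` for the
  rational algebraic generators);
* `transc_of_isAlgebraicCorrespondence₂` — **an algebraic correspondence `f : H²(S) → H²(S')` maps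
  `T(S)_ℂ = {y | y ⊥ N¹(S)}` into `T(S')_ℂ`** (adjunction `⟨f y, w⟩_{S'} = ⟨ᵗf w, y⟩_S` with the ALGEBRAIC
  transpose `ᵗf : H²(S') → H²(S)`, which maps `N¹(S')` into `N¹(S)`);
* `exists_homAlg_of_isRationalClass₂` — **`[γ]_*` for a RATIONAL algebraic `γ ∈ A²(S' × S)` descends to
  a morphism of Hodge structures `a : T(S)_ℚ → T(S')_ℚ`** between the sub-Hodge structures on the
  transcendental lattices, `[γ]_*(t ⊗ 1) = a(t) ⊗ 1`.

THEOREMS ONLY; no definition, no named fact, no sorry; credits nothing to the Hodge conjecture.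
Prover seat hodge-nonav-19652-p1 (gen 15), `--supports stmt-HodgeConjecture-19652`.

References: W. Fulton, *Intersection Theory*, §16.1 (correspondences, transpose); C. Voisin, *Hodge
Theory I*, §7.1.1, §7.3.1, Thm. 11.30, Lemma 11.41; M. Varesco, Math. Z. 305 (2023), §0.3 and Thm. 4.5;
D. Huybrechts, *Lectures on K3 Surfaces*, Ch. 3 Lemma 3.1.
-/

set_option linter.dupNamespace false

noncomputable section

namespace Summit.HodgeConjecture.HodgeConjecture.Theorems.MarkmanPartnerTransport.KugaSatakePair

open scoped TensorProduct
open CategoryTheory MonoidalCategory Literature.AlgebraicGeometry Literature.AlgebraicGeometry.Motives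
open Literature.AlgebraicGeometry.HodgeTheory Literature.AlgebraicTopology.SingularHomology
open Literature.AlgebraicGeometry.Motives.HodgeStructure
open Literature.AlgebraicGeometry.Surfaces
open Summit.HodgeConjecture.HodgeConjecture.Theorems.OddPrimeSquares
open Summit.HodgeConjecture.HodgeConjecture.Theorems.MarkmanPartnerTransport.TranscendentalPresentation
open Summit.HodgeConjecture.HodgeConjecture.Theorems.MarkmanPartnerTransport.KugaSatakeSelf
open Summit.HodgeConjecture.HodgeConjecture.Ring2.AbelianAll

variable {S S' : SchemeOver ℂ}

/-- `H²_B(S)`: the weight-two `ℚ`-Hodge structure on `H²(S(ℂ); ℚ)` of the real Hodge model of `S`. -/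
local notation3 "H²[" hS "]" =>
  bettiTwoHodgeStructure hS (BettiUniverse.realHodgeModel exists_isReal_hodgeModel_holds hS)
    (BettiUniverse.realHodgeModel_isHodgeSymmetric exists_isReal_hodgeModel_holds hS)

/-- `T(S)_ℚ = Hdg¹^⊥ ⊆ H²(S(ℂ); ℚ)`. -/
local notation3 "T[" hS "]" =>
  transcendentalLatticeBetti hS (BettiUniverse.realHodgeModel exists_isReal_hodgeModel_holds hS)
    (BettiUniverse.realHodgeModel_isHodgeSymmetric exists_isReal_hodgeModel_holds hS)

/-- `ι : H²(S(ℂ); ℚ) → H²(S(ℂ); ℂ)`, the rational lattice. -/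
local notation3 "ι[" S "]" => ofRatClass (Motives.ComplexPoints S) (2 * 1)

/-- `Transc[S, y]`: `y` is cup-orthogonal to `N¹(S) = algebraicClasses S 1`. Local notation only. -/
local notation3 (prettyPrint := false) "Transc[" S ", " y "]" =>
  (∀ d ∈ algebraicClasses S 1, cupProduct (rfl : 2 * 1 + 2 * 1 = 2 * 2) y d = 0)

/-! ### §1 Correspondences map complexified Hodge classes to algebraic classes -/

/-- **`[γ]_*` maps the complexified Hodge classes `ι n'`, `n' ∈ Hdg¹(S')`, into `N¹(S)`** for every
`γ ∈ A^e(S ⊗ S') ⊗ ℂ` acting `H²(S') → H²(S)` (`γ` is a `ℂ`-combination of RATIONAL algebraic classes;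
for those, `[γₖ]_*(ι n')` is a rational `(1,1)`-class on `S`, algebraic by Lefschetz `(1,1)`).
[cite: VoisinHodgeI2002, Thm. 11.30 and Lemma 11.41] [cite: Fulton1998, §16.1] -/
theorem corrAction_ofRatClass_mem_algebraicClasses₂ (hS : IsSmoothProjective 2 S) (hS' : IsSmoothProjective 2 S')
    {e : ℕ} (hab : 2 * 1 + 2 * e = 2 * 1 + 2 * 2) {γ : complexBetti (S ⊗ S') (2 * e)}
    (hγ : γ ∈ algebraicClasses (S ⊗ S') e)
    {n : bettiCohomology S' (2 * 1)} (hn : n ∈ (H²[hS']).hodgeClasses 1) :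
    corrAction complexOrientationFamily hS hS' hab γ (ι[S'] n) ∈ algebraicClasses S 1 := by
  have hnN := ofRatClass_mem_algebraicClasses_of_mem_hodgeClasses hS' hn
  have hn11 := isOfHodgeType_of_mem_algebraicClasses_of_isSmoothProjective hS' 1 hnN
  have hγ' := (le_of_eq (supportedClasses_eq_span_isRationalClass (hS.tensor_holds hS') (2 * e) e)) hγ
  clear hγ
  induction hγ' using Submodule.span_induction with
  | mem γ hγ =>
    have hγt : IsOfHodgeType (2 + 2) (S ⊗ S') (2 * e) e e γ :=
      isOfHodgeType_of_mem_algebraicClasses_of_isSmoothProjective (hS.tensor_holds hS') e hγ.2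
    have h1 : IsRationalClass (corrAction complexOrientationFamily hS hS' hab γ (ι[S'] n)) :=
      Arapura2006.isRationalClass_corrAction_complex hS hS' hab hγ.1 (isRationalClass_ofRatClass _)
    have h2 : IsOfHodgeType 2 S (2 * 1) 1 1 (corrAction complexOrientationFamily hS hS' hab γ (ι[S'] n)) :=
      Arapura2006.isOfHodgeType_corrAction_complex hS hS' hab hγt (by omega) (by omega) hn11
    exact lefschetzOneOne_rational_holds hS _ h1 h2
  | zero => rw [map_zero, LinearMap.zero_apply]; exact Submodule.zero_mem _
  | add γ γ' _ _ h h' => rw [map_add, LinearMap.add_apply]; exact Submodule.add_mem _ h h'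
  | smul c γ _ h => rw [map_smul, LinearMap.smul_apply]; exact Submodule.smul_mem _ c h

/-! ### §2 Correspondences `S → S'` carry `T(S)_ℂ` into `T(S')_ℂ` -/

/-- **An algebraic correspondence `f : H²(S) → H²(S')` maps `T(S)_ℂ` into `T(S')_ℂ`**: for `y ⊥ N¹(S)`,
`f y ⊥ N¹(S')` (adjunction `⟨f y, w⟩_{S'} = ⟨ᵗf w, y⟩_S` with the algebraic transpose `ᵗf`, which maps the
complexified Hodge classes of `S'` into `N¹(S)`; then `N¹(S') = Θ'(Hdg¹(S')_ℂ)` by linearity).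
[cite: Fulton1998, §16.1] [cite: VoisinHodgeI2002, Thm. 11.30] -/
theorem transc_of_isAlgebraicCorrespondence₂ (hS : IsSmoothProjective 2 S) (hS' : IsSmoothProjective 2 S')
    {f : complexBetti S (2 * 1) →ₗ[ℂ] complexBetti S' (2 * 1)} (hf : IsAlgebraicCorrespondence 2 2 S' S f)
    {y : complexBetti S (2 * 1)} (hy : Transc[S, y]) : Transc[S', f y] := by
  have ha : 2 * 1 + 2 * 1 = 2 * 2 := rfl
  obtain ⟨ft, hft, hadj⟩ := IsAlgebraicCorrespondence.exists_transpose hS' hS ha ha hf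
  obtain ⟨e, hab, γ, hγ, rfl⟩ := IsAlgebraicCorrespondence.exists_eq_corrAction hS hS' hft
  -- on the complexified Hodge classes `ι n`, `n ∈ Hdg¹(S')`
  have key : ∀ n : bettiCohomology S' (2 * 1), n ∈ (H²[hS']).hodgeClasses 1 →
      cupProduct (rfl : 2 * 1 + 2 * 1 = 2 * 2) (f y) (ι[S'] n) = 0 := by
    intro n hn
    have hmem := corrAction_ofRatClass_mem_algebraicClasses₂ hS hS' hab hγ hn
    have h0 : cupPairing (complexOrientationFamily hS) ha
        (corrAction complexOrientationFamily hS hS' hab γ (ι[S'] n)) y = 0 := by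
      rw [cupPairing_apply, cupProduct_gradedComm_holds ℂ (Motives.ComplexPoints S) ha rfl _ y, hy _ hmem,
        smul_zero, map_zero, LinearMap.zero_apply]
    have h3 := hadj y (ι[S'] n)
    rw [h0, mul_zero, cupPairing_apply] at h3
    apply eq_zero_of_traceC_eq_zero hS'
    rw [traceC_apply, h3, mul_zero]
  -- extend to `N¹(S') = Θ'(Hdg¹_ℂ)` by linearity
  intro c hc
  rw [← map_hodgeClasses_baseChange_eq_algebraicClasses hS'] at hc
  obtain ⟨u, hu, rfl⟩ := hc
  obtain ⟨u', rfl⟩ := hu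
  induction u' using TensorProduct.induction_on with
  | zero => rw [map_zero, map_zero, map_zero]
  | tmul a n =>
    rw [LinearMap.baseChange_tmul, Submodule.subtype_apply, ofRatClassBaseChange_tmul, map_smul, key _ n.2,
      smul_zero]
  | add x y hx hy => rw [map_add, map_add, map_add, hx, hy, add_zero]

/-! ### §3 Rational correspondences `S → S'` descend to `Hom_HS(T(S)_ℚ, T(S')_ℚ)` -/

/-- **A RATIONAL algebraic correspondence `[γ]_* : H²(S) → H²(S')` descends to a morphism of Hodge
structures `T(S)_ℚ → T(S')_ℚ`**: for sub-Hodge structures `T ⊆ H²_B(S)`, `T' ⊆ H²_B(S')` on the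
transcendental lattices and a rational algebraic `γ ∈ A^e(S' × S)`, there is `a : Hom T T'` with
`[γ]_*(t ⊗ 1) = a(t) ⊗ 1` for `t ∈ T(S)_ℚ` (`[γ]_*` is rational and type-preserving, so it descends to
`Hom(H²_B(S), H²_B(S'))` — `exists_hom_ofRatClass_eq₂` — and it carries `T(S)` into `T(S')`,
`transc_of_isAlgebraicCorrespondence₂`). [cite: VoisinHodgeI2002, §7.3.1 and Lemma 11.41] [cite: Fulton1998, §16.1] -/
theorem exists_homAlg_of_isRationalClass₂ (hS : IsSmoothProjective 2 S) (hS' : IsSmoothProjective 2 S')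
    (T : SubHodgeStructure (H²[hS])) (hT : T.toSubmodule = T[hS])
    (T' : SubHodgeStructure (H²[hS'])) (hT' : T'.toSubmodule = T[hS'])
    {e : ℕ} (hab : 2 * 1 + 2 * e = 2 * 1 + 2 * 2)
    {γ : complexBetti (S' ⊗ S) (2 * e)} (hγ : γ ∈ algebraicClasses (S' ⊗ S) e) (hγQ : IsRationalClass γ) :
    ∃ a : Hom T.toHodgeStructure T'.toHodgeStructure,
      ∀ t : T.toSubmodule, corrAction complexOrientationFamily hS' hS hab γ (ι[S] (t : bettiCohomology S (2 * 1))) =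
        ι[S'] ((a.toLinearMap t : T'.toSubmodule) : bettiCohomology S' (2 * 1)) := by
  set f := corrAction complexOrientationFamily hS' hS hab γ with hf
  have hfalg : IsAlgebraicCorrespondence 2 2 S' S f :=
    isAlgebraicCorrespondence_corrAction_complex hS' hS hab (by norm_num) hγ
  have hγt : IsOfHodgeType (2 + 2) (S' ⊗ S) (2 * e) e e γ :=
    isOfHodgeType_of_mem_algebraicClasses_of_isSmoothProjective (hS'.tensor_holds hS) e hγ
  have h1 : ∀ y, IsRationalClass y → IsRationalClass (f y) :=
    fun y hy => Arapura2006.isRationalClass_corrAction_complex hS' hS hab hγQ hy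
  have h2 : ∀ (i j : ℕ) y, IsOfHodgeType 2 S (2 * 1) i j y → IsOfHodgeType 2 S' (2 * 1) i j (f y) :=
    fun i j y hy => Arapura2006.isOfHodgeType_corrAction_complex hS' hS hab hγt (by omega) (by omega) hy
  obtain ⟨Ψ, hΨ⟩ := exists_hom_ofRatClass_eq₂ hS hS' f h1 h2
  have hmem : ∀ t : T.toSubmodule, (Ψ.comp T.subtypeHom).toLinearMap t ∈ T'.toSubmodule := by
    intro t
    have ht : Transc[S, ι[S] (t : bettiCohomology S (2 * 1))] :=
      (mem_transcendental_iff_transc hS _).1 ((le_of_eq hT : T.toSubmodule ≤ T[hS]) t.2)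
    have h : Ψ.toLinearMap (t : bettiCohomology S (2 * 1)) ∈ T[hS'] := by
      rw [mem_transcendental_iff_transc hS', hΨ]
      exact transc_of_isAlgebraicCorrespondence₂ hS hS' hfalg ht
    exact (le_of_eq hT'.symm : T[hS'] ≤ T'.toSubmodule) h
  exact ⟨(Ψ.comp T.subtypeHom).codRestrict T' hmem, fun t => (hΨ _).symm⟩

end Summit.HodgeConjecture.HodgeConjecture.Theorems.MarkmanPartnerTransport.KugaSatakePair

end
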